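import Mathlib
import Literature.Probability.LatticeModels.RandomCluster
import Literature.Probability.Percolation.Crossings
import Literature.Probability.RandomPlanarGeometry.ConformalRectangle
import Summits.CriticalPhenomena.CardyFormulaZ2.Theorems.CardyQContinuationPivotalCancellationAtOneJets
import Summits.CriticalPhenomena.CardyFormulaZ2.Theorems.CardyQContinuationUniformZeroFreeWiring

/-!
# `s² Z_joint = Z_sep + (s² − 1) N` — joint versus separate wiring of the arcs (crux UniformZeroFree)

Support file for crux `UniformZeroFree` (stmt-CriticalPhenomena-5559) of route `CardyQContinuation`.
The route weights `ω ⊆ E(Ω_δ)` by `s^(|ω| + 2 k_B(ω))` with the discrete arcs `A = (ab)_δ`, `B = (cd)_δ`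
wired JOINTLY; Miller–Werner and Chelkak–Smirnov wire them SEPARATELY.  Using the abstract component count of
`…Theorems.CardyQContinuationUniformZeroFreeWiring` we prove, for the route's own objects:

* `wiring_crossing_iff` — `ω ∈ C_δ` (Smirnov's open crossing of `Ω_δ` between the discrete arcs) iff the two
  arcs are joined in the separately wired open graph on the discrete domain;
* `wiring_clusterCount_sep_eq` / registered `wiring_count` — `k_sep(ω) = k_B(ω) + 𝟙[ω ∉ C_δ]`;
* `wiring_sq_mul_arcZ` / registered `wiring_identity` — `s² · Z_joint(s) = Z_sep(s) + (s² − 1) · N(s)` for every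
  complex `s` (both discrete arcs nonempty), i.e. the crossing ratios of the two wirings are Möbius-related:
  `N/Z_joint = s² P_sep / (1 + (s² − 1) P_sep)`, `P_sep = N/Z_sep`.

Why the crux cares (lead c3, `Cruxes/UniformZeroFree/Lines/birth-gadgets-c3.md` §6): restating the crux on the
RATIO `P = N/Z` cancels pendant boundary gadgets, but through this Möbius relation a neck gadget `G` in series
(`P_sep = P_A · π_G · P_B`) still plants a pole of `P_joint` next to every zero of the free polynomial of `G`.
[folklore; Grimmett2006 §1.2 (wired cluster counts)]
-/

namespace Summit.CriticalPhenomena.CardyFormulaZ2.Theorems.UniformZeroFree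

open SimpleGraph

/-! ### The crux objects: discrete arcs, the domain, and the crossing event -/

section Crux

open Literature.Probability.LatticeModels Literature.Probability.Percolation
  Literature.Probability.RandomPlanarGeometry

/-- The open graph of a configuration supported on the edges of `Ω_δ` is a subgraph of `Ω_δ`. [folklore] -/
theorem wiring_openGraph_le {Ω : Set ℂ} {δ : ℝ} {ω : Set (Sym2 (Site 2))}
    (hω : ω ⊆ (discreteDomainGraph Ω δ).edgeSet) : openGraph ω ≤ discreteDomainGraph Ω δ := by
  intro x y h
  rw [openGraph, SimpleGraph.fromEdgeSet_adj] at h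
  exact hω h.1

/-- Separately wired arcs, restricted to the discrete domain: the induced graph splits as
`G_ω|_D ⊔ wired A' ⊔ wired B'` with `A'`, `B'` the arcs seen inside the subtype `↥D`. [folklore] -/
theorem wiring_induce_sep_eq (Gω : SimpleGraph (Site 2)) (A B D : Set (Site 2)) :
    (Gω ⊔ wired A ⊔ wired B).induce D =
      Gω.induce D ⊔ wired {v : D | (v : Site 2) ∈ A} ⊔ wired {v : D | (v : Site 2) ∈ B} := by
  ext ⟨x, hx⟩ ⟨y, hy⟩
  simp only [SimpleGraph.induce_adj, SimpleGraph.sup_adj, wired_adj, ne_eq, Subtype.mk.injEq,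
    Set.mem_setOf_eq]

/-- Jointly wired arcs, restricted to the discrete domain. [folklore] -/
theorem wiring_induce_joint_eq (Gω : SimpleGraph (Site 2)) (A B D : Set (Site 2)) :
    (Gω ⊔ wired (A ∪ B)).induce D =
      Gω.induce D ⊔ wired ({v : D | (v : Site 2) ∈ A} ∪ {v : D | (v : Site 2) ∈ B}) := by
  ext ⟨x, hx⟩ ⟨y, hy⟩
  simp only [SimpleGraph.induce_adj, SimpleGraph.sup_adj, wired_adj, ne_eq, Subtype.mk.injEq,
    Set.mem_setOf_eq, Set.mem_union]

/-- An open crossing of `Ω_δ` between the arcs gives a path inside the induced open graph on the discrete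
domain `D ⊇` arcs (every vertex of a path of `Ω_δ` lies in `D`). [folklore] -/
theorem wiring_induce_reachable_of_crossing {Ω : Set ℂ} {δ : ℝ} {ω : Set (Sym2 (Site 2))}
    {x y : Site 2} (hx : x ∈ meshDomain Ω δ) (hy : y ∈ meshDomain Ω δ)
    (h : (openGraph ω ⊓ discreteDomainGraph Ω δ).Reachable x y) :
    ((openGraph ω).induce (meshDomain Ω δ)).Reachable ⟨x, hx⟩ ⟨y, hy⟩ := by
  rw [SimpleGraph.reachable_iff_reflTransGen] at h
  suffices H : ∀ z, Relation.ReflTransGen (openGraph ω ⊓ discreteDomainGraph Ω δ).Adj x z →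
      ∃ hz : z ∈ meshDomain Ω δ, ((openGraph ω).induce (meshDomain Ω δ)).Reachable ⟨x, hx⟩ ⟨z, hz⟩ by
    obtain ⟨_, h'⟩ := H y h
    exact h'
  intro z hz
  induction hz with
  | refl => exact ⟨hx, SimpleGraph.Reachable.refl _⟩
  | tail _ hvw ih =>
    obtain ⟨hv, hreach⟩ := ih
    rw [SimpleGraph.inf_adj] at hvw
    have hw : _ ∈ meshDomain Ω δ := (discreteDomainGraph_adj_iff.1 hvw.2).2.2
    refine ⟨hw, hreach.trans (SimpleGraph.Adj.reachable ?_)⟩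
    rw [SimpleGraph.induce_adj]
    exact hvw.1

/-- A path in the induced open graph on `D` from a vertex of arc `A` to a vertex of arc `B` is an open
crossing (the induced open graph maps into `G_ω ⊓ Ω_δ` along the subtype inclusion). [folklore] -/
theorem wiring_crossing_of_induce_reachable {Ω : Set ℂ} {δ : ℝ} {ω : Set (Sym2 (Site 2))}
    (hω : ω ⊆ (discreteDomainGraph Ω δ).edgeSet) {A B : Set ℂ}
    {a b : meshDomain Ω δ} (ha : (a : Site 2) ∈ discreteArc Ω δ A) (hb : (b : Site 2) ∈ discreteArc Ω δ B)
    (h : ((openGraph ω).induce (meshDomain Ω δ)).Reachable a b) :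
    ω ∈ discreteCrossing Ω δ A B := by
  let f : (openGraph ω).induce (meshDomain Ω δ) →g openGraph ω ⊓ discreteDomainGraph Ω δ :=
    { toFun := Subtype.val
      map_rel' := fun {u v} huv => by
        rw [SimpleGraph.induce_adj] at huv
        rw [SimpleGraph.inf_adj]
        exact ⟨huv, wiring_openGraph_le hω huv⟩ }
  exact ⟨a, ha, b, hb, h.map f⟩

/-- **Crossing ⇔ the two arcs are joined in the separately wired graph on the discrete domain.**
[folklore] -/
theorem wiring_crossing_iff {Ω : Set ℂ} {δ : ℝ} {ω : Set (Sym2 (Site 2))}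
    (hω : ω ⊆ (discreteDomainGraph Ω δ).edgeSet) (A B : Set ℂ) :
    ω ∈ discreteCrossing Ω δ A B ↔
      ∃ a ∈ {v : meshDomain Ω δ | (v : Site 2) ∈ discreteArc Ω δ A},
        ∃ b ∈ {v : meshDomain Ω δ | (v : Site 2) ∈ discreteArc Ω δ B},
          ((openGraph ω).induce (meshDomain Ω δ) ⊔ wired {v : meshDomain Ω δ | (v : Site 2) ∈ discreteArc Ω δ A} ⊔
            wired {v : meshDomain Ω δ | (v : Site 2) ∈ discreteArc Ω δ B}).Reachable a b := by
  set D := meshDomain Ω δ with hD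
  set A' : Set D := {v : D | (v : Site 2) ∈ discreteArc Ω δ A} with hA'
  set B' : Set D := {v : D | (v : Site 2) ∈ discreteArc Ω δ B} with hB'
  have hAD : discreteArc Ω δ A ⊆ D :=
    (discreteArc_subset_meshBoundary Ω δ A).trans (meshBoundary_subset_meshDomain Ω δ)
  have hBD : discreteArc Ω δ B ⊆ D :=
    (discreteArc_subset_meshBoundary Ω δ B).trans (meshBoundary_subset_meshDomain Ω δ)
  constructor
  · rintro ⟨x, hx, y, hy, hxy⟩
    refine ⟨⟨x, hAD hx⟩, hx, ⟨y, hBD hy⟩, hy, ?_⟩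
    exact (wiring_induce_reachable_of_crossing (hAD hx) (hBD hy) hxy).mono
      (le_sup_left.trans le_sup_left)
  · rintro ⟨a, ha, b, hb, hab⟩
    by_contra hnc
    -- the set of vertices reachable from arc `A` through OPEN edges only
    let T : Set D := {v | ∃ a' : D, (a' : Site 2) ∈ discreteArc Ω δ A ∧ ((openGraph ω).induce D).Reachable a' v}
    have hclosed : ∀ ⦃u v : D⦄, u ∈ T →
        ((openGraph ω).induce D ⊔ wired A' ⊔ wired B').Adj u v → v ∈ T := by
      rintro u v ⟨a', ha', hu⟩ huv
      simp only [SimpleGraph.sup_adj, wired_adj] at huv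
      rcases huv with (huv | ⟨-, -, hvA⟩) | ⟨-, huB, -⟩
      · exact ⟨a', ha', hu.trans huv.reachable⟩
      · exact ⟨v, hvA, SimpleGraph.Reachable.refl _⟩
      · exact absurd (wiring_crossing_of_induce_reachable hω ha' huB hu) hnc
    have hbT : b ∈ T :=
      wiring_reachable_mem_of_closed hclosed ⟨a, ha, SimpleGraph.Reachable.refl _⟩ hab
    obtain ⟨a', ha', hb'⟩ := hbT
    exact hnc (wiring_crossing_of_induce_reachable hω ha' hb hb')

open scoped Classical in
/-- **Per-configuration bookkeeping `k_sep = k_joint + [no crossing]`** for the crux's objects: the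
cluster count with the arcs `(ab)_δ`, `(cd)_δ` wired separately exceeds the jointly wired count `k_B`
exactly when there is no open crossing (both discrete arcs nonempty). [folklore; Grimmett2006 §1.2] -/
theorem wiring_clusterCount_sep_eq (R : ConformalRectangle) {δ : ℝ} (hδ : 0 < δ)
    {ω : Set (Sym2 (Site 2))} (hω : ω ⊆ (discreteDomainGraph R.carrier δ).edgeSet)
    (hA : (discreteArc R.carrier δ (R.arc 0)).Nonempty) (hB : (discreteArc R.carrier δ (R.arc 2)).Nonempty) :
    Nat.card ((openGraph ω ⊔ wired (discreteArc R.carrier δ (R.arc 0)) ⊔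
        wired (discreteArc R.carrier δ (R.arc 2))).induce (meshDomain R.carrier δ)).ConnectedComponent =
      Nat.card ((openGraph ω ⊔ wired (discreteArc R.carrier δ (R.arc 0) ∪
        discreteArc R.carrier δ (R.arc 2))).induce (meshDomain R.carrier δ)).ConnectedComponent +
      (if ω ∈ discreteCrossing R.carrier δ (R.arc 0) (R.arc 2) then 0 else 1) := by
  classical
  haveI : Finite (meshDomain R.carrier δ) := (meshDomain_finite R.isBounded hδ).to_subtype
  rw [wiring_induce_sep_eq, wiring_induce_joint_eq]
  have hAD : discreteArc R.carrier δ (R.arc 0) ⊆ meshDomain R.carrier δ :=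
    (discreteArc_subset_meshBoundary _ δ _).trans (meshBoundary_subset_meshDomain _ δ)
  have hBD : discreteArc R.carrier δ (R.arc 2) ⊆ meshDomain R.carrier δ :=
    (discreteArc_subset_meshBoundary _ δ _).trans (meshBoundary_subset_meshDomain _ δ)
  have hA' : ({v : meshDomain R.carrier δ | (v : Site 2) ∈ discreteArc R.carrier δ (R.arc 0)}).Nonempty := by
    obtain ⟨x, hx⟩ := hA; exact ⟨⟨x, hAD hx⟩, hx⟩
  have hB' : ({v : meshDomain R.carrier δ | (v : Site 2) ∈ discreteArc R.carrier δ (R.arc 2)}).Nonempty := by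
    obtain ⟨x, hx⟩ := hB; exact ⟨⟨x, hBD hx⟩, hx⟩
  rw [wiring_card_connectedComponent _ hA' hB']
  congr 1
  by_cases hc : ω ∈ discreteCrossing R.carrier δ (R.arc 0) (R.arc 2)
  · rw [if_pos hc, if_pos ((wiring_crossing_iff hω _ _).1 hc)]
  · rw [if_neg hc, if_neg (fun h => hc ((wiring_crossing_iff hω _ _).2 h))]

/-- The termwise identity behind `s² Z_joint = Z_sep + (s² − 1) N`. [folklore] -/
theorem wiring_term_identity (s : ℂ) (n kj : ℕ) (c : Prop) [Decidable c] :
    s ^ 2 * s ^ (n + 2 * kj) =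
      s ^ (n + 2 * (kj + if c then 0 else 1)) + (s ^ 2 - 1) * (if c then s ^ (n + 2 * kj) else 0) := by
  by_cases hc : c
  · simp only [if_pos hc, add_zero]; ring
  · simp only [if_neg hc, mul_zero, add_zero]; ring

/-- **`s² · Z_joint = Z_sep + (s² − 1) · N`** — the crux's jointly wired arc partition function, the
separately wired one (Miller–Werner / Chelkak–Smirnov wiring) and the crossing-restricted one are tied by a
linear identity with polynomial coefficients; equivalently the crossing ratios are Möbius-related,
`P_joint = s² P_sep / (1 + (s² − 1) P_sep)`.  Both discrete arcs are assumed nonempty. [folklore] -/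
theorem wiring_sq_mul_arcZ (R : ConformalRectangle) {δ : ℝ} (hδ : 0 < δ)
    (hA : (discreteArc R.carrier δ (R.arc 0)).Nonempty) (hB : (discreteArc R.carrier δ (R.arc 2)).Nonempty) (s : ℂ) :
    s ^ 2 * (∑ᶠ ω ∈ 𝒫 (discreteDomainGraph R.carrier δ).edgeSet, s ^ (ω.ncard + 2 * Nat.card ((openGraph ω ⊔ wired (discreteArc R.carrier δ (R.arc 0) ∪ discreteArc R.carrier δ (R.arc 2))).induce (meshDomain R.carrier δ)).ConnectedComponent)) =
      (∑ᶠ ω ∈ 𝒫 (discreteDomainGraph R.carrier δ).edgeSet, s ^ (ω.ncard + 2 * Nat.card ((openGraph ω ⊔ wired (discreteArc R.carrier δ (R.arc 0)) ⊔ wired (discreteArc R.carrier δ (R.arc 2))).induce (meshDomain R.carrier δ)).ConnectedComponent)) +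
      (s ^ 2 - 1) * ∑ᶠ ω ∈ 𝒫 (discreteDomainGraph R.carrier δ).edgeSet, (discreteCrossing R.carrier δ (R.arc 0) (R.arc 2)).indicator (fun ω ↦ s ^ (ω.ncard + 2 * Nat.card ((openGraph ω ⊔ wired (discreteArc R.carrier δ (R.arc 0) ∪ discreteArc R.carrier δ (R.arc 2))).induce (meshDomain R.carrier δ)).ConnectedComponent)) ω := by
  classical
  have hfin : (𝒫 (discreteDomainGraph R.carrier δ).edgeSet).Finite :=
    (Summit.CriticalPhenomena.CardyFormulaZ2.Theorems.finite_edgeSet_discreteDomainGraph R.isBounded hδ).finite_subsets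
  rw [finsum_mem_eq_finite_toFinset_sum _ hfin, finsum_mem_eq_finite_toFinset_sum _ hfin,
    finsum_mem_eq_finite_toFinset_sum _ hfin, Finset.mul_sum, Finset.mul_sum, ← Finset.sum_add_distrib]
  refine Finset.sum_congr rfl fun ω hω => ?_
  have hωE : ω ⊆ (discreteDomainGraph R.carrier δ).edgeSet := by
    simpa only [Set.Finite.mem_toFinset, Set.mem_powerset_iff] using hω
  rw [wiring_clusterCount_sep_eq R hδ hωE hA hB, Set.indicator_apply]
  convert wiring_term_identity s ω.ncard _ (ω ∈ discreteCrossing R.carrier δ (R.arc 0) (R.arc 2)) using 3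

end Crux

/-! ### Registered forms (closed statements, fully qualified) -/

section Registered

/-- **Registered stub `wiring_count`** (crux stmt-CriticalPhenomena-5559): per-configuration bookkeeping
`k_sep(ω) = k_B(ω) + 𝟙[ω ∉ C_δ]` between the separately and the jointly wired arc cluster counts of the
route's discrete domain, for both discrete arcs nonempty. [folklore; Grimmett2006 §1.2] -/
theorem wiring_count : ∀ R : Literature.Probability.RandomPlanarGeometry.ConformalRectangle, ∀ δ : ℝ, 0 < δ → (Literature.Probability.LatticeModels.discreteArc R.carrier δ (R.arc 0)).Nonempty → (Literature.Probability.LatticeModels.discreteArc R.carrier δ (R.arc 2)).Nonempty → ∀ ω ⊆ (Literature.Probability.LatticeModels.discreteDomainGraph R.carrier δ).edgeSet, Nat.card ((Literature.Probability.Percolation.openGraph ω ⊔ Literature.Probability.LatticeModels.wired (Literature.Probability.LatticeModels.discreteArc R.carrier δ (R.arc 0)) ⊔ Literature.Probability.LatticeModels.wired (Literature.Probability.LatticeModels.discreteArc R.carrier δ (R.arc 2))).induce (Literature.Probability.LatticeModels.meshDomain R.carrier δ)).ConnectedComponent = Nat.card ((Literature.Probability.Percolation.openGraph ω ⊔ Literature.Probability.LatticeModels.wired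 (Literature.Probability.LatticeModels.discreteArc R.carrier δ (R.arc 0) ∪ Literature.Probability.LatticeModels.discreteArc R.carrier δ (R.arc 2))).induce (Literature.Probability.LatticeModels.meshDomain R.carrier δ)).ConnectedComponent + (Literature.Probability.Percolation.discreteCrossing R.carrier δ (R.arc 0) (R.arc 2))ᶜ.indicator 1 ω := by
  classical
  intro R δ hδ hA hB ω hω
  rw [wiring_clusterCount_sep_eq R hδ hω hA hB]
  by_cases hc : ω ∈ Literature.Probability.Percolation.discreteCrossing R.carrier δ (R.arc 0) (R.arc 2)
  · have h1 : ω ∉ (Literature.Probability.Percolation.discreteCrossing R.carrier δ (R.arc 0) (R.arc 2))ᶜ :=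
      fun h => h hc
    rw [if_pos hc, Set.indicator_of_notMem h1]
  · rw [if_neg hc, Set.indicator_of_mem hc, Pi.one_apply]

/-- **Registered stub `wiring_identity`** (crux stmt-CriticalPhenomena-5559): the linear identity
`s² · Z_joint(s) = Z_sep(s) + (s² − 1) · N(s)` between the route's jointly wired arc partition function
`Z_joint = Z_δ`, the separately wired one `Z_sep` and the crossing-restricted `N = N_δ`; equivalently the
crossing ratios in the two wirings are Möbius-related, `N/Z_joint = s² P_sep / (1 + (s² − 1) P_sep)`.
[folklore; Grimmett2006 §1.2] -/
theorem wiring_identity : ∀ R : Literature.Probability.RandomPlanarGeometry.ConformalRectangle, ∀ δ : ℝ, 0 < δ → (Literature.Probability.LatticeModels.discreteArc R.carrier δ (R.arc 0)).Nonempty → (Literature.Probability.LatticeModels.discreteArc R.carrier δ (R.arc 2)).Nonempty → ∀ s : ℂ, s ^ 2 * (∑ᶠ ω ∈ 𝒫 (Literature.Probability.LatticeModels.discreteDomainGraph R.carrier δ).edgeSet, s ^ (ω.ncard + 2 * Nat.card ((Literature.Probability.Percolation.openGraph ω ⊔ Literature.Probability.LatticeModels.wired (Literature.Probability.LatticeModels.discreteArc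 R.carrier δ (R.arc 0) ∪ Literature.Probability.LatticeModels.discreteArc R.carrier δ (R.arc 2))).induce (Literature.Probability.LatticeModels.meshDomain R.carrier δ)).ConnectedComponent)) = (∑ᶠ ω ∈ 𝒫 (Literature.Probability.LatticeModels.discreteDomainGraph R.carrier δ).edgeSet, s ^ (ω.ncard + 2 * Nat.card ((Literature.Probability.Percolation.openGraph ω ⊔ Literature.Probability.LatticeModels.wired (Literature.Probability.LatticeModels.discreteArc R.carrier δ (R.arc 0)) ⊔ Literature.Probability.LatticeModels.wired (Literature.Probability.LatticeModels.discreteArc R.carrier δ (R.arc 2))).induce (Literature.Probability.LatticeModels.meshDomain R.carrier δ)).ConnectedComponent)) + (s ^ 2 - 1) * ∑ᶠ ω ∈ 𝒫 (Literature.Probability.LatticeModels.discreteDomainGraph R.carrier δ).edgeSet, (Literature.Probability.Percolation.discreteCrossing R.carrier δ (R.arc 0) (R.arc 2)).indicator (fun ω ↦ s ^ (ω.ncard + 2 * Nat.card ((Literature.Probability.Percolation.openGraph ω ⊔ Literature.Probability.LatticeModels.wired (Literature.Probability.LatticeModels.discreteArc R.carrier δ (R.arc 0) ∪ Literature.Probability.LatticeModels.discreteArc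 R.carrier δ (R.arc 2))).induce (Literature.Probability.LatticeModels.meshDomain R.carrier δ)).ConnectedComponent)) ω :=
  fun R _ hδ hA hB s => wiring_sq_mul_arcZ R hδ hA hB s

end Registered

end Summit.CriticalPhenomena.CardyFormulaZ2.Theorems.UniformZeroFree
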